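import Summits.HubbardSuperconductivity.HubbardSuperconductivity.Theorems.AnisotropyChordTransferFibre3FinXDCheck

/-!
# Route `AnisotropyChord` / H0 rotor rung: FIN per-`L` row-D (KT-2a″) SUB-CELL facts, `L = 9` (84–89)

Row-D facts `xdCellAny0 9 (49/50) la lb aD = true` on quarter sub-cells of the combined cells whose side condition needs `aD ≈ .04` (mechhunt STATUS p3 g7 REPORT 3).
Prover seat `hubbard-h0-rotor-p3` g7; helper for piece A = stmt-HubbardSuperconductivity-23918 of rung 19089 (`--supports`, helper class).
WHAT THIS IS NOT: nothing here proves superconductivity in the Hubbard model (rotor TARGET as worded stays FALSE, g15 verdict); kernel facts /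
assembly for ONE conditional reduction at one `L`.  No sorry.
-/

set_option linter.dupNamespace false
set_option autoImplicit false

namespace Summit.HubbardSuperconductivity.HubbardSuperconductivity.Theorems.AnisotropyChord.Transfer.Fibre3

namespace FinXD

/-- row-D sub-cell `[18065310710914649, 18178218902857865]` of `L = 9`. [folklore] -/
theorem xd9s_132_0 : xdCellAny0 9 (49/50 : ℚ) 18065310710914649 18178218902857865 (1/25 : ℚ) = true := by decide +kernel

/-- row-D sub-cell `[18178218902857865, 18291127094801081]` of `L = 9`. [folklore] -/
theorem xd9s_132_1 : xdCellAny0 9 (49/50 : ℚ) 18178218902857865 18291127094801081 (1/25 : ℚ) = true := by decide +kernel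

/-- row-D sub-cell `[18291127094801081, 18404035286744297]` of `L = 9`. [folklore] -/
theorem xd9s_132_2 : xdCellAny0 9 (49/50 : ℚ) 18291127094801081 18404035286744297 (1/25 : ℚ) = true := by decide +kernel

/-- row-D sub-cell `[18404035286744297, 18516943478687513]` of `L = 9`. [folklore] -/
theorem xd9s_132_3 : xdCellAny0 9 (49/50 : ℚ) 18404035286744297 18516943478687513 (1/25 : ℚ) = true := by decide +kernel

/-- row-D sub-cell `[18516943478687513, 18632674375429310]` of `L = 9`. [folklore] -/
theorem xd9s_133_0 : xdCellAny0 9 (49/50 : ℚ) 18516943478687513 18632674375429310 (1/25 : ℚ) = true := by decide +kernel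

/-- row-D sub-cell `[18632674375429310, 18748405272171107]` of `L = 9`. [folklore] -/
theorem xd9s_133_1 : xdCellAny0 9 (49/50 : ℚ) 18632674375429310 18748405272171107 (1/25 : ℚ) = true := by decide +kernel

end FinXD

end Summit.HubbardSuperconductivity.HubbardSuperconductivity.Theorems.AnisotropyChord.Transfer.Fibre3
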